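import Literature.Barriers.AnomalousDissipation.ObukhovCorrsinThresholdBesov
import HarnessLib

/-!
# The Obukhov–Corrsin threshold, `L¹`-velocity corner: no velocity regularity at all

Barrier-audit addendum (2026-08-17, gen 12, D-0021) to the named fact
`Literature.Barriers.AnomalousDissipation.DrivasElgindiIyerJeong2022_thm4`
(`Barriers/AnomalousDissipation/ObukhovCorrsinThreshold`, scope caveat (iii), so far on paper).
The Constantin–E–Titi flux term `∫ ∇θ̄_ℓ · τ_ℓ(u,θ)` of Drivas–Elgindi–Iyer–Jeong 2022, (5.9),
sees the velocity only through the `L¹` translation modulus `‖u(· - y) - u‖_{L¹}`, `‖y‖ ≤ ℓ`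
(`BesovCorner.neg_integral_conv_mul_flux_le_of_modulus`), and that modulus is at most
`2‖u‖_{L¹}` with NO regularity: `‖τ_ℓ(u,θ)‖_{L¹} ≤ 4 ‖u‖_{L¹} [θ]_β ℓ^β`, whence the fixed-scale
bound (5.10) with `ℓ^{α+2β-1}‖u‖_{L¹_t C^α}` replaced by `2 ℓ^{2β-1} ‖u‖_{L¹_{t,x}}` (the
`α = 0` end of the Besov corner `DrivasElgindiIyerJeong2022_thm4_besov`, which requires `0 < α`),
and at the scale `ℓ = c κ`:
`κ ∫₀ᵀ ‖∇θ‖²_{L²} ≤ C κ^{2β-1}`, `C = C(d, T, β, K, M, κ₀)`, for EVERY divergence-free velocity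
field of the weak-solution class with `∫₀ᵀ ‖u(t)‖_{L¹} ≤ K` and `u(t)` bounded for a.e. `t`
(no uniformity; needed by the slice identity only). Consequently (corollary
`DrivasElgindiIyerJeong2022_thm4_l1Velocity.noAnomalousScalarDissipation`): along ANY family of
divergence-free fields bounded in `L¹((0,T) × T^d)` — in particular any family of finite, uniformly
bounded mean kinetic energy, e.g. Leray–Hopf velocities under an energy bound, `j`-dependent, no
convergence and no regularity asked — scalars bounded in `L^∞_t C^β` for some `β > 1/2` carry no
anomalous dissipation on `[0,T]`. For the catalogue this is the first corner of the block that asks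
nothing of the velocity but integrability: the threshold `β* = (1-α)/2` read at `α = 0`.

## Contents

* `two_mul_eScalarDissipation_le_l1Velocity` — the bound (5.10) at fixed scale `ε` with the
  velocity entering through `∫₀ᵀ‖u‖_{L¹}` only (shape of `two_mul_eScalarDissipation_le_besov` at
  `α = 0` with `K` doubled);
* `L1VelocityCorner.scale_bound_zero` — the optimisation `ℓ = c κ`;
* `DrivasElgindiIyerJeong2022_thm4_l1Velocity` — the theorem, `≤ C κ^{2β-1}`;
* `DrivasElgindiIyerJeong2022_thm4_l1Velocity.noAnomalousScalarDissipation` — families, `β > 1/2`.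

## Mathlib / tree search

Tree: `ObukhovCorrsinThresholdBesov` (`BesovCorner.neg_integral_conv_mul_flux_le_of_modulus`,
the model proof `two_mul_eScalarDissipation_le_besov`), `ObukhovCorrsinThresholdProofs`
(`setLIntegral_Ioo_le_of_ae_le`), `PassiveScalarEnergyMollified`
(`IsWeakScalarTransportOn.ae_integral_sq_molInt_eq`), `HolderNorm` (`eSupNorm`). Mathlib:
`eLpNorm_comp_measurePreserving`, `measurePreserving_sub_right`, `eLpNorm_sub_le`.

## References

* T. D. Drivas, T. M. Elgindi, G. Iyer, I.-J. Jeong, Arch. Ration. Mech. Anal. 243 (2022)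
  1151–1180, Thm. 4 and its proof, §5, (5.8)–(5.10) (arXiv:1911.03271). Bib key `DrivasEtAl2022`.
* P. Constantin, W. E, E. S. Titi, Comm. Math. Phys. 165 (1994), 207–209, (6)–(11). Bib key
  `ConstantinETiti1994`.
* M. Colombo, G. Crippa, M. Sorella, Ann. PDE 9 (2023), Paper No. 21, Thm. 1 (the flexible side
  at `α = 0`: bounded fields, scalars bounded in `L^{p°}_t C^β` for every `β < 1/2`;
  arXiv:2207.06833). Bib key `ColomboCrippaSorella2023`.
-/

open MeasureTheory Set Filter Topology Function
open scoped ENNReal NNReal Convolution InnerProductSpace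

noncomputable section

namespace Literature.Barriers.AnomalousDissipation

open Literature.Analysis Literature.Analysis.FunctionSpaces Literature.Analysis.FluidPDE

namespace L1VelocityCorner

variable {d : Type*} [Fintype d]

/-- **The `L¹` translation modulus costs nothing**: for `f` a.e. strongly measurable on the torus
and any `y`, `‖f(· - y) - f‖_{L¹} ≤ 2 ‖f‖_{L¹}` (Minkowski and translation invariance of the Haar
measure). [folklore] -/
theorem eLpNorm_comp_sub_sub_le_two_mul {f : UnitAddTorus d → ℝ} (hf : AEStronglyMeasurable f volume)
    (y : UnitAddTorus d) :
    eLpNorm (fun x => f (x - y) - f x) 1 volume ≤ 2 * eLpNorm f 1 volume := by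
  have htr : eLpNorm (fun x => f (x - y)) 1 volume = eLpNorm f 1 volume :=
    eLpNorm_comp_measurePreserving hf (measurePreserving_sub_right volume y)
  have hfm : AEStronglyMeasurable (fun x => f (x - y)) volume :=
    hf.comp_quasiMeasurePreserving (measurePreserving_sub_right volume y).quasiMeasurePreserving
  calc eLpNorm (fun x => f (x - y) - f x) 1 volume
      = eLpNorm ((fun x => f (x - y)) - f) 1 volume := rfl
    _ ≤ eLpNorm (fun x => f (x - y)) 1 volume + eLpNorm f 1 volume := eLpNorm_sub_le hfm hf le_rfl
    _ = 2 * eLpNorm f 1 volume := by rw [htr, two_mul]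

/-- **The scale optimisation at `α = 0`** (`ℓ = c κ`): for `0 < κ ≤ κ₀`, `c > 0`, `A ≥ 0`,
`A (cκ)^{2β} + B (cκ)^{2β-1} + D κ (cκ)^{2β-2} ≤ (A c^{2β} κ₀ + B c^{2β-1} + D c^{2β-2}) κ^{2β-1}`.
[folklore] -/
theorem scale_bound_zero {β κ κ₀ c A : ℝ} (B D : ℝ) (hκ : 0 < κ) (hκ₀ : κ ≤ κ₀) (hc : 0 < c)
    (hA : 0 ≤ A) :
    A * (c * κ) ^ (2 * β) + B * (c * κ) ^ (2 * β - 1) + D * (κ * (c * κ) ^ (2 * β - 2)) ≤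
      (A * (c ^ (2 * β) * κ₀) + B * c ^ (2 * β - 1) + D * c ^ (2 * β - 2)) * κ ^ (2 * β - 1) := by
  have hpow : ∀ p : ℝ, (c * κ) ^ p = c ^ p * κ ^ p := fun p => Real.mul_rpow hc.le hκ.le
  have t1 : κ ^ (2 * β) = κ ^ (2 * β - 1) * κ := by
    conv_lhs => rw [show (2 * β : ℝ) = (2 * β - 1) + 1 by ring, Real.rpow_add hκ, Real.rpow_one]
  have t3 : κ * κ ^ (2 * β - 2) = κ ^ (2 * β - 1) := by
    conv_lhs => rw [← Real.rpow_one κ]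
    rw [← Real.rpow_mul hκ.le, one_mul, ← Real.rpow_add hκ]
    congr 1
    ring
  rw [hpow, hpow, hpow, t1]
  have hκe : 0 ≤ κ ^ (2 * β - 1) := Real.rpow_nonneg hκ.le _
  have hc2 : 0 ≤ A * c ^ (2 * β) := mul_nonneg hA (Real.rpow_nonneg hc.le _)
  calc A * (c ^ (2 * β) * (κ ^ (2 * β - 1) * κ)) + B * (c ^ (2 * β - 1) * κ ^ (2 * β - 1)) +
        D * (κ * (c ^ (2 * β - 2) * κ ^ (2 * β - 2)))
      = (A * c ^ (2 * β) * κ + B * c ^ (2 * β - 1) + D * c ^ (2 * β - 2)) * κ ^ (2 * β - 1) := by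
        rw [← t3]; ring
    _ ≤ (A * c ^ (2 * β) * κ₀ + B * c ^ (2 * β - 1) + D * c ^ (2 * β - 2)) * κ ^ (2 * β - 1) := by
        gcongr
    _ = _ := by ring

end L1VelocityCorner

/-! ## The dissipation bound at a fixed mollification scale, `L¹` velocity -/

/-- **The bound (5.10) at `t = 0` with an `L¹` velocity** (barrier audit 2026-08-17, gen 12; scope
caveat (iii) of `DrivasElgindiIyerJeong2022_thm4`): as
`DrivasElgindiIyerJeong2022_thm4.two_mul_eScalarDissipation_le` /
`two_mul_eScalarDissipation_le_besov`, with the velocity hypothesis replaced by slicewise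
boundedness (no uniformity) and `∫₀ᵀ ‖u(t)‖_{L¹} ≤ K` — no regularity of `u` whatsoever — and
`0 < ε ≤ 1/4`:
`2κ ∫₀ᵀ ‖∇θ‖²_{L²} ≤ M² ε^{2β} + 2 (2 · (2 d C₁ M² ε^{2β-1}) K + T κ d C₁² M² ε^{2β-2})`,
`C₁ = Torus.gradProfileMass d`, `d = card d` (the velocity enters the flux only through
`‖τ_ε(u,θ)‖_{L¹} ≤ 2 · (2‖u(t)‖_{L¹}) · [θ]_β ε^β`). [cite: DrivasEtAl2022, proof of Thm. 4, (5.9)–(5.10)] -/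
theorem two_mul_eScalarDissipation_le_l1Velocity {d : Type*} [Fintype d]
    [DecidableEq d] {T : ℝ} (hT : 0 < T) {β : ℝ≥0} (hβ : 0 < β) {K M : ℝ≥0}
    {u : ℝ → UnitAddTorus d → EuclideanSpace ℝ d}
    (hub : ∀ᵐ t ∂((volume : Measure ℝ).restrict (Ioo 0 T)), eSupNorm (u t) < ⊤)
    (huK : ∫⁻ t in Ioo 0 T, eLpNorm (u t) 1 volume ≤ K) {θ₀ : UnitAddTorus d → ℝ}
    (hθ₀ : eBoundedHolderNorm β θ₀ ≤ M) {κ : ℝ} (hκ : 0 < κ) {θ : ℝ → UnitAddTorus d → ℝ}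
    (hθ : Torus.IsWeakScalarTransportOn T κ u θ₀ θ)
    (henergy : ∀ᵐ t ∂((volume : Measure ℝ).restrict (Ioo 0 T)),
      (∫⁻ x, ‖θ t x‖ₑ ^ 2) + 2 * Torus.eScalarDissipation κ θ 0 t ≤ ∫⁻ x, ‖θ₀ x‖ₑ ^ 2)
    (hbound : ∀ᵐ t ∂((volume : Measure ℝ).restrict (Ioo 0 T)), eBoundedHolderNorm β (θ t) ≤ M)
    {ε : ℝ} (hε : 0 < ε) (hε' : ε ≤ 1 / 4) :
    2 * Torus.eScalarDissipation κ θ 0 T ≤ ENNReal.ofReal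
      ((M : ℝ) ^ 2 * ε ^ (2 * (β : ℝ)) +
        2 * ((2 * (2 * Fintype.card d * Torus.gradProfileMass d * (M : ℝ) ^ 2 * ε ^ (2 * (β : ℝ) - 1))) * K +
          T * (κ * (Fintype.card d * (Torus.gradProfileMass d ^ 2 * (M : ℝ) ^ 2 * ε ^ (2 * (β : ℝ) - 2)))))) := by
  -- the datum
  have hMtop : ((M : ℝ≥0∞)) < ⊤ := ENNReal.coe_lt_top
  have nn_le : ∀ {f : UnitAddTorus d → ℝ}, eBoundedHolderNorm β f ≤ M → HolderWith M β f ∧ Continuous f := by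
    intro f hf
    have hB : MemBoundedHolder β f := lt_of_le_of_lt hf hMtop
    refine ⟨Torus.holderWith_of_nnHolderNorm_le hB.memHolder (ENNReal.coe_le_coe.1 ?_), hB.continuous hβ⟩
    rw [hB.memHolder.coe_nnHolderNorm_eq_eHolderNorm]
    exact (eHolderNorm_le_eBoundedHolderNorm β f).trans hf
  have hθ₀H : HolderWith M β θ₀ := (nn_le hθ₀).1
  have hθ₀c : Continuous θ₀ := (nn_le hθ₀).2
  have hθ₀i : Integrable θ₀ volume := hθ₀c.integrable_unitAddTorus
  set k : UnitAddTorus d → ℝ := Torus.kernel ε with hk_def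
  have hk : Torus.IsSmooth k := Torus.isSmooth_kernel hε hε'
  -- constants and exponent bookkeeping
  set C₁ : ℝ := Torus.gradProfileMass d with hC₁
  have hC₁0 : 0 ≤ C₁ := Torus.gradProfileMass_nonneg
  set c₁ : ℝ := 2 * (2 * Fintype.card d * C₁ * (M : ℝ) ^ 2 * ε ^ (2 * (β : ℝ) - 1)) with hc₁
  set c₂ : ℝ := κ * (Fintype.card d * (C₁ ^ 2 * (M : ℝ) ^ 2 * ε ^ (2 * (β : ℝ) - 2))) with hc₂
  have hc₁0 : 0 ≤ c₁ := by positivity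
  have hc₂0 : 0 ≤ c₂ := by positivity
  have i1 : ((M : ℝ) * ε ^ (β : ℝ)) ^ 2 = (M : ℝ) ^ 2 * ε ^ (2 * (β : ℝ)) := by
    rw [mul_pow, ← Real.rpow_natCast (ε ^ (β : ℝ)) 2, ← Real.rpow_mul hε.le]
    congr 2
    push_cast
    ring
  have i2 : ε⁻¹ * ε ^ (β : ℝ) * ε ^ (β : ℝ) = ε ^ (2 * (β : ℝ) - 1) := by
    rw [← Real.rpow_neg_one ε, ← Real.rpow_add hε, ← Real.rpow_add hε]
    congr 1
    ring
  have i3 : (ε⁻¹ * ε ^ (β : ℝ)) ^ 2 = ε ^ (2 * (β : ℝ) - 2) := by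
    rw [← Real.rpow_neg_one ε, ← Real.rpow_add hε, ← Real.rpow_natCast _ 2, ← Real.rpow_mul hε.le]
    congr 1
    push_cast
    ring
  -- Step 1: the slice bound, for a.e. `s`
  have hslice : ∀ᵐ s ∂((volume : Measure ℝ).restrict (Ioo 0 T)),
      -(∫ x, ((θ s) ⋆ k) x * ∫ y, θ s y *
        (-⟪u s y, Torus.gradient k (x - y)⟫_ℝ + κ * Torus.laplacian k (x - y))) ≤
        c₁ * (eLpNorm (u s) 1 volume).toReal + c₂ := by
    filter_upwards [hbound, hub, hθ.ae_isWeaklyDivFree, hθ.ae_aestronglyMeasurable_velocity_slice]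
      with s hsM hsb hdiv hum
    have hθsH : HolderWith M β (θ s) := (nn_le hsM).1
    have hθsc : Continuous (θ s) := (nn_le hsM).2
    have hCv : ∀ y, ‖u s y‖ ≤ (eSupNorm (u s)).toReal := fun y => by
      rw [← toReal_enorm]
      exact ENNReal.toReal_mono hsb.ne (enorm_le_eSupNorm (u s) y)
    -- the `L¹` norm of `u s` is finite (bounded function on a finite measure space)
    set S : ℝ≥0∞ := eLpNorm (u s) 1 volume with hS
    have hStop : S ≠ ⊤ := by
      refine (lt_of_le_of_lt ?_ (ENNReal.mul_lt_top hsb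
        (measure_lt_top (volume : Measure (UnitAddTorus d)) univ))).ne
      rw [hS, eLpNorm_one_eq_lintegral_enorm, ← lintegral_const]
      exact lintegral_mono fun x => enorm_le_eSupNorm (u s) x
    -- the `L¹` translation modulus of `u s`: at most `2 ‖u s‖_{L¹}`, any `y`
    set Av : ℝ≥0∞ := 2 * S with hAv
    have hAvtop : Av ≠ ⊤ := ENNReal.mul_ne_top ENNReal.ofNat_ne_top hStop
    have hAvj : ∀ j, ∀ y : UnitAddTorus d, ‖y‖ ≤ ε →
        eLpNorm (fun x => u s (x - y) j - u s x j) 1 volume ≤ Av := by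
      intro j y _hy
      have humj : AEStronglyMeasurable (fun x => u s x j) volume :=
        (PiLp.continuous_apply 2 (fun _ : d => ℝ) j).comp_aestronglyMeasurable hum
      have hcompj : eLpNorm (fun x => u s x j) 1 volume ≤ S :=
        eLpNorm_mono fun x => PiLp.norm_apply_le (u s x) j
      calc eLpNorm (fun x => u s (x - y) j - u s x j) 1 volume
          ≤ 2 * eLpNorm (fun x => u s x j) 1 volume :=
            L1VelocityCorner.eLpNorm_comp_sub_sub_le_two_mul humj y
        _ ≤ 2 * S := by gcongr
    have h := BesovCorner.neg_integral_conv_mul_flux_le_of_modulus hθsc hθsH hum hCv hdiv hε hε'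
      hAvtop hAvj hκ.le
    have hAvR : Av.toReal = 2 * S.toReal := by
      rw [hAv, ENNReal.toReal_mul, ENNReal.toReal_ofNat]
    calc _ ≤ _ := h
      _ = c₁ * S.toReal + c₂ := by
          rw [hAvR, hc₁, hc₂, ← i2, ← i3]
          ring
  -- Step 2: the time integral of the slice bound, in `ℝ≥0∞`
  have hKint : ∫⁻ s in Ioo 0 T, ENNReal.ofReal ((eLpNorm (u s) 1 volume).toReal) ≤ K :=
    (lintegral_mono fun s => ENNReal.ofReal_toReal_le).trans huK
  have htime : ∀ t ∈ Ioo 0 T,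
      ENNReal.ofReal (∫ s in Ioc 0 t, -(∫ x, ((θ s) ⋆ k) x * ∫ y, θ s y *
        (-⟪u s y, Torus.gradient k (x - y)⟫_ℝ + κ * Torus.laplacian k (x - y)))) ≤
        ENNReal.ofReal c₁ * K + ENNReal.ofReal c₂ * ENNReal.ofReal T := by
    intro t ht
    refine (ofReal_integral_le_lintegral_ofReal _).trans ?_
    refine (lintegral_mono_set (Ioc_subset_Ioo_right ht.2)).trans ?_
    have hmono : ∫⁻ s in Ioo 0 T, ENNReal.ofReal (-(∫ x, ((θ s) ⋆ k) x * ∫ y, θ s y *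
        (-⟪u s y, Torus.gradient k (x - y)⟫_ℝ + κ * Torus.laplacian k (x - y)))) ≤
        ∫⁻ s in Ioo 0 T, (ENNReal.ofReal c₁ * ENNReal.ofReal ((eLpNorm (u s) 1 volume).toReal) + ENNReal.ofReal c₂) := by
      refine lintegral_mono_ae (hslice.mono fun s hs => ?_)
      have hb0 : 0 ≤ (eLpNorm (u s) 1 volume).toReal := ENNReal.toReal_nonneg
      rw [← ENNReal.ofReal_mul hc₁0, ← ENNReal.ofReal_add (mul_nonneg hc₁0 hb0) hc₂0]
      exact ENNReal.ofReal_le_ofReal hs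
    refine hmono.trans ?_
    rw [lintegral_add_right _ measurable_const, lintegral_const_mul' _ _ ENNReal.ofReal_ne_top,
      lintegral_const, Measure.restrict_apply_univ, Real.volume_Ioo, sub_zero]
    gcongr
  -- Step 3: the bound for a.e. `t`
  have hmain : ∀ᵐ t ∂((volume : Measure ℝ).restrict (Ioo 0 T)), 2 * Torus.eScalarDissipation κ θ 0 t ≤
      ENNReal.ofReal ((M : ℝ) ^ 2 * ε ^ (2 * (β : ℝ))) + 2 * (ENNReal.ofReal c₁ * K + ENNReal.ofReal c₂ * ENNReal.ofReal T) := by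
    filter_upwards [henergy, hθ.ae_integral_sq_molInt_eq hθ₀i hk, ae_restrict_mem measurableSet_Ioo,
      hθ.ae_slice_integrable₁] with t hen hid htT hint
    have hθti : Integrable (θ t) volume := hint.1
    have hAc : Continuous ((θ t) ⋆ k) := Torus.continuous_convolution hθti hk.continuous
    -- Young: `‖θ(t) ⋆ k‖₂ ≤ ‖θ(t)‖₂`
    have hY : ∫⁻ x, ‖((θ t) ⋆ k) x‖ₑ ^ 2 ≤ ∫⁻ x, ‖θ t x‖ₑ ^ 2 := by
      rw [← PassiveScalarProofs.eLpNorm_two_pow_two, ← PassiveScalarProofs.eLpNorm_two_pow_two]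
      gcongr
      calc eLpNorm ((θ t) ⋆ k) 2 volume ≤ (∫⁻ y, ‖k y‖ₑ) * eLpNorm (θ t) 2 volume :=
            Torus.eLpNorm_convolution_le hθti.aestronglyMeasurable hk.continuous.aestronglyMeasurable one_le_two
        _ = eLpNorm (θ t) 2 volume := by rw [hk_def, Torus.lintegral_enorm_kernel hε hε', one_mul]
    have e0 : ∫⁻ x, ‖θ₀ x‖ₑ ^ 2 = ENNReal.ofReal (∫ x, θ₀ x ^ 2) :=
      Torus.lintegral_enorm_sq_eq_ofReal_integral_sq hθ₀c
    have eA : ∫⁻ x, ‖((θ t) ⋆ k) x‖ₑ ^ 2 = ENNReal.ofReal (∫ x, ((θ t) ⋆ k) x ^ 2) :=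
      Torus.lintegral_enorm_sq_eq_ofReal_integral_sq hAc
    have h1 : ENNReal.ofReal (∫ x, ((θ t) ⋆ k) x ^ 2) + 2 * Torus.eScalarDissipation κ θ 0 t ≤
        ENNReal.ofReal (∫ x, θ₀ x ^ 2) := by
      rw [← eA, ← e0]
      exact (add_le_add hY le_rfl).trans hen
    have h2 : 2 * Torus.eScalarDissipation κ θ 0 t ≤
        ENNReal.ofReal ((∫ x, θ₀ x ^ 2) - ∫ x, ((θ t) ⋆ k) x ^ 2) := by
      rw [ENNReal.ofReal_sub _ (integral_nonneg fun x => sq_nonneg _)]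
      exact ENNReal.le_sub_of_add_le_left ENNReal.ofReal_ne_top h1
    have h3 : (∫ x, θ₀ x ^ 2) - ∫ x, ((θ t) ⋆ k) x ^ 2 ≤ (M : ℝ) ^ 2 * ε ^ (2 * (β : ℝ)) +
        2 * ∫ s in Ioc 0 t, -(∫ x, ((θ s) ⋆ k) x * ∫ y, θ s y *
          (-⟪u s y, Torus.gradient k (x - y)⟫_ℝ + κ * Torus.laplacian k (x - y))) := by
      rw [hid, integral_neg, ← i1]
      have := Torus.integral_sq_sub_integral_convolution_sq_le hθ₀c hθ₀H hε hε'
      linarith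
    calc 2 * Torus.eScalarDissipation κ θ 0 t
        ≤ ENNReal.ofReal ((∫ x, θ₀ x ^ 2) - ∫ x, ((θ t) ⋆ k) x ^ 2) := h2
      _ ≤ ENNReal.ofReal ((M : ℝ) ^ 2 * ε ^ (2 * (β : ℝ)) +
          2 * ∫ s in Ioc 0 t, -(∫ x, ((θ s) ⋆ k) x * ∫ y, θ s y *
            (-⟪u s y, Torus.gradient k (x - y)⟫_ℝ + κ * Torus.laplacian k (x - y)))) :=
          ENNReal.ofReal_le_ofReal h3
      _ ≤ ENNReal.ofReal ((M : ℝ) ^ 2 * ε ^ (2 * (β : ℝ))) +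
          ENNReal.ofReal (2 * ∫ s in Ioc 0 t, -(∫ x, ((θ s) ⋆ k) x * ∫ y, θ s y *
            (-⟪u s y, Torus.gradient k (x - y)⟫_ℝ + κ * Torus.laplacian k (x - y)))) :=
          ENNReal.ofReal_add_le
      _ ≤ _ := by
          rw [ENNReal.ofReal_mul zero_le_two, ENNReal.ofReal_ofNat]
          gcongr
          exact htime t htT
  -- Step 4: from a.e. `t` to `T`
  have h2D : ∀ t, 2 * Torus.eScalarDissipation κ θ 0 t =
      ∫⁻ s in Ioo 0 t, 2 * (ENNReal.ofReal κ * Torus.eScalarGradNormSq (θ s)) := fun t => by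
    rw [Torus.eScalarDissipation, ← lintegral_const_mul' _ _ ENNReal.ofReal_ne_top,
      ← lintegral_const_mul' _ _ ENNReal.ofNat_ne_top]
  have hfin : 2 * Torus.eScalarDissipation κ θ 0 T ≤
      ENNReal.ofReal ((M : ℝ) ^ 2 * ε ^ (2 * (β : ℝ))) + 2 * (ENNReal.ofReal c₁ * K + ENNReal.ofReal c₂ * ENNReal.ofReal T) := by
    rw [h2D]
    refine setLIntegral_Ioo_le_of_ae_le hT ?_
    filter_upwards [hmain] with t ht
    rwa [h2D] at ht
  refine hfin.trans (le_of_eq ?_)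
  have e2 : ENNReal.ofReal c₁ * (K : ℝ≥0∞) + ENNReal.ofReal c₂ * ENNReal.ofReal T =
      ENNReal.ofReal (c₁ * K + T * c₂) := by
    rw [ENNReal.ofReal_add (by positivity) (by positivity), ENNReal.ofReal_mul hc₁0,
      ENNReal.ofReal_coe_nnreal, ENNReal.ofReal_mul (le_of_lt hT),
      mul_comm (ENNReal.ofReal T) (ENNReal.ofReal c₂)]
  have e3 : (2 : ℝ≥0∞) * ENNReal.ofReal (c₁ * K + T * c₂) = ENNReal.ofReal (2 * (c₁ * K + T * c₂)) := by
    rw [ENNReal.ofReal_mul zero_le_two, ENNReal.ofReal_ofNat]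
  rw [e2, e3]
  exact (ENNReal.ofReal_add (by positivity) (by positivity)).symm

/-! ## The theorem, `L¹`-velocity corner -/

/-- **The Obukhov–Corrsin threshold with a merely integrable velocity** (barrier audit
2026-08-17, gen 12: scope caveat (iii) of `DrivasElgindiIyerJeong2022_thm4` made a theorem). Let
`T > 0`, `β ∈ (0,1]`. For all bounds `K, M, κ₀` there is `C = C(d, T, β, K, M, κ₀)` such that:
whenever `u` is a divergence-free velocity field of the weak-solution class, bounded at a.e. time
(no uniformity), with `∫₀ᵀ ‖u(t)‖_{L¹(T^d)} dt ≤ K` — NO REGULARITY of `u` — `θ₀ ∈ C^{0,β}` with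
`‖θ₀‖_{C^{0,β}} ≤ M`, `0 < κ ≤ κ₀`, and `θ` is a weak solution of `∂ₜθ + u·∇θ = κΔθ`, `θ(0) = θ₀`
on `T^d × [0,T)` obeying the energy balance and `ess sup_t ‖θ(t)‖_{C^{0,β}} ≤ M`, then
`κ ∫₀ᵀ ‖∇θ‖²_{L²} ≤ C κ^{2β-1}` — the exponent `(α+2β-1)/(α+1)` of the named fact read at
`α = 0`; explicitly `C = ½ M² (c^{2β} κ₀ + 8 d C₁ K c^{2β-1} + 2 d C₁² T c^{2β-2})`,
`c = ¼ κ₀⁻¹`, `C₁ = Torus.gradProfileMass d`. In particular scalars bounded in `L^∞_t C^β`,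
`β > 1/2`, carry no anomalous dissipation in ANY family of divergence-free fields bounded in
`L¹((0,T) × T^d)` (corollary below); `β < 1/2` is flexible already for bounded fields, with
time-integrated scalar bounds [cite: ColomboCrippaSorella2023, Thm. 1].
[cite: DrivasEtAl2022, Thm. 4 and its proof, (5.9)–(5.10)] -/
theorem DrivasElgindiIyerJeong2022_thm4_l1Velocity (d : Type) [Fintype d] [DecidableEq d] (T : ℝ)
    (hT : 0 < T) (β : ℝ≥0) (hβ : 0 < β ∧ β ≤ 1) (K M κ₀ : ℝ≥0) :
    ∃ C : ℝ≥0,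
      ∀ (u : ℝ → UnitAddTorus d → EuclideanSpace ℝ d)
        (_hub : ∀ᵐ t ∂(volume.restrict (Ioo 0 T)), eSupNorm (u t) < ⊤)
        (_huK : ∫⁻ t in Ioo 0 T, eLpNorm (u t) 1 volume ≤ K)
        (θ₀ : UnitAddTorus d → ℝ) (_hθ₀ : eBoundedHolderNorm β θ₀ ≤ M)
        (κ : ℝ) (_hκ : 0 < κ) (_hκ₀ : κ ≤ κ₀)
        (θ : ℝ → UnitAddTorus d → ℝ) (_hθ : Torus.IsWeakScalarTransportOn T κ u θ₀ θ)
        (_henergy : ∀ᵐ t ∂(volume.restrict (Ioo 0 T)),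
          (∫⁻ x, ‖θ t x‖ₑ ^ 2) + 2 * Torus.eScalarDissipation κ θ 0 t ≤ ∫⁻ x, ‖θ₀ x‖ₑ ^ 2)
        (_hbound : ∀ᵐ t ∂(volume.restrict (Ioo 0 T)), eBoundedHolderNorm β (θ t) ≤ M),
        Torus.eScalarDissipation κ θ 0 T ≤ ENNReal.ofReal (C * κ ^ (2 * (β : ℝ) - 1)) := by
  rcases eq_zero_or_pos κ₀ with hκ₀ | hκ₀
  · refine ⟨0, ?_⟩
    intro u _ _ θ₀ _ κ hκ hκκ₀
    exact absurd (hκ.trans_le hκκ₀) (by simp [hκ₀])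
  have hκ₀' : (0 : ℝ) < κ₀ := hκ₀
  -- the scale `ε = c κ`
  set c : ℝ := 4⁻¹ * (κ₀ : ℝ)⁻¹ with hc
  have hc0 : 0 < c := by positivity
  set C₁ : ℝ := Torus.gradProfileMass d with hC₁
  have hC₁0 : 0 ≤ C₁ := Torus.gradProfileMass_nonneg
  set Cr : ℝ := 2⁻¹ * ((M : ℝ) ^ 2 * (c ^ (2 * (β : ℝ)) * (κ₀ : ℝ)) +
      (2 * (2 * (2 * Fintype.card d * C₁ * (M : ℝ) ^ 2)) * K) * c ^ (2 * (β : ℝ) - 1) +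
      (2 * (T * (Fintype.card d * (C₁ ^ 2 * (M : ℝ) ^ 2)))) * c ^ (2 * (β : ℝ) - 2)) with hCr
  have hCr0 : 0 ≤ Cr := by positivity
  refine ⟨Cr.toNNReal, ?_⟩
  intro u hub huK θ₀ hθ₀ κ hκ hκκ₀ θ hθ henergy hbound
  set ε : ℝ := c * κ with hε_def
  have hε : 0 < ε := by positivity
  have hε' : ε ≤ 1 / 4 := by
    have h1 : (κ₀ : ℝ)⁻¹ * κ ≤ 1 := by
      rw [inv_mul_le_iff₀ hκ₀', mul_one]
      exact_mod_cast hκκ₀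
    calc ε = 4⁻¹ * ((κ₀ : ℝ)⁻¹ * κ) := by rw [hε_def, hc, mul_assoc]
      _ ≤ 4⁻¹ * 1 := by gcongr
      _ = 1 / 4 := by norm_num
  have hraw := two_mul_eScalarDissipation_le_l1Velocity hT hβ.1 hub huK hθ₀ hκ hθ henergy hbound hε hε'
  -- optimisation in `ℓ`
  have hscale := L1VelocityCorner.scale_bound_zero (β := (β : ℝ)) (κ₀ := (κ₀ : ℝ))
    (2 * (2 * (2 * Fintype.card d * C₁ * (M : ℝ) ^ 2)) * K)
    (2 * (T * (Fintype.card d * (C₁ ^ 2 * (M : ℝ) ^ 2)))) hκ (by exact_mod_cast hκκ₀) hc0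
    (sq_nonneg (M : ℝ))
  have hreal : (M : ℝ) ^ 2 * ε ^ (2 * (β : ℝ)) +
      2 * ((2 * (2 * Fintype.card d * C₁ * (M : ℝ) ^ 2 * ε ^ (2 * (β : ℝ) - 1))) * K +
        T * (κ * (Fintype.card d * (C₁ ^ 2 * (M : ℝ) ^ 2 * ε ^ (2 * (β : ℝ) - 2))))) ≤
      2 * ((Cr.toNNReal : ℝ≥0) * κ ^ (2 * (β : ℝ) - 1)) := by
    rw [Real.coe_toNNReal _ hCr0, hCr]
    calc _ = (M : ℝ) ^ 2 * (c * κ) ^ (2 * (β : ℝ)) +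
          2 * (2 * (2 * Fintype.card d * C₁ * (M : ℝ) ^ 2)) * K * (c * κ) ^ (2 * (β : ℝ) - 1) +
          2 * (T * (Fintype.card d * (C₁ ^ 2 * (M : ℝ) ^ 2))) * (κ * (c * κ) ^ (2 * (β : ℝ) - 2)) := by
          rw [hε_def]; ring
      _ ≤ _ := hscale
      _ = _ := by ring
  calc Torus.eScalarDissipation κ θ 0 T
      ≤ 2⁻¹ * (2 * Torus.eScalarDissipation κ θ 0 T) := by
        rw [← mul_assoc, ENNReal.inv_mul_cancel two_ne_zero ENNReal.ofNat_ne_top, one_mul]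
    _ ≤ 2⁻¹ * ENNReal.ofReal (2 * ((Cr.toNNReal : ℝ≥0) * κ ^ (2 * (β : ℝ) - 1))) := by
        gcongr
        exact hraw.trans (ENNReal.ofReal_le_ofReal hreal)
    _ = ENNReal.ofReal ((Cr.toNNReal : ℝ≥0) * κ ^ (2 * (β : ℝ) - 1)) := by
        rw [ENNReal.ofReal_mul zero_le_two, ENNReal.ofReal_ofNat, ← mul_assoc,
          ENNReal.inv_mul_cancel two_ne_zero ENNReal.ofNat_ne_top, one_mul]

/-- **No anomalous scalar dissipation above `β = 1/2`, along families, in integrable fields**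
(barrier audit 2026-08-17, gen 12; corollary of `DrivasElgindiIyerJeong2022_thm4_l1Velocity`). Let
`1/2 < β ≤ 1`, `κ_j > 0` with `κ_j → 0`, and for each `j` a divergence-free field `u_j` of the
weak-solution class, bounded at a.e. time, with `∫₀ᵀ ‖u_j(t)‖_{L¹} ≤ K` (fields may vary with `j`;
no convergence, no regularity — e.g. any family of uniformly bounded mean kinetic energy), data
`θ₀,ⱼ` with `‖θ₀,ⱼ‖_{C^{0,β}} ≤ M`, and weak solutions `θ_j` of `∂ₜθ + u_j·∇θ = κ_jΔθ` obeying the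
energy balance and `ess sup_t ‖θ_j(t)‖_{C^{0,β}} ≤ M`. Then `κ_j ∫₀ᵀ ‖∇θ_j‖²_{L²} → 0`.
[cite: DrivasEtAl2022, Thm. 4] -/
theorem DrivasElgindiIyerJeong2022_thm4_l1Velocity.noAnomalousScalarDissipation
    (d : Type) [Fintype d] [DecidableEq d] (T : ℝ)
    (hT : 0 < T) (β : ℝ≥0) (hβ : 1 / 2 < (β : ℝ) ∧ β ≤ 1) (K M : ℝ≥0)
    (u : ℕ → ℝ → UnitAddTorus d → EuclideanSpace ℝ d)
    (hub : ∀ j, ∀ᵐ t ∂(volume.restrict (Ioo 0 T)), eSupNorm (u j t) < ⊤)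
    (huK : ∀ j, ∫⁻ t in Ioo 0 T, eLpNorm (u j t) 1 volume ≤ K)
    (θ₀ : ℕ → UnitAddTorus d → ℝ) (hθ₀ : ∀ j, eBoundedHolderNorm β (θ₀ j) ≤ M)
    (κ : ℕ → ℝ) (hκ : ∀ j, 0 < κ j) (hκ₀ : Tendsto κ atTop (𝓝 0))
    (θ : ℕ → ℝ → UnitAddTorus d → ℝ)
    (hθ : ∀ j, Torus.IsWeakScalarTransportOn T (κ j) (u j) (θ₀ j) (θ j))
    (henergy : ∀ j, ∀ᵐ t ∂(volume.restrict (Ioo 0 T)),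
      (∫⁻ x, ‖θ j t x‖ₑ ^ 2) + 2 * Torus.eScalarDissipation (κ j) (θ j) 0 t ≤ ∫⁻ x, ‖θ₀ j x‖ₑ ^ 2)
    (hbound : ∀ j, ∀ᵐ t ∂(volume.restrict (Ioo 0 T)), eBoundedHolderNorm β (θ j t) ≤ M) :
    Tendsto (fun j => Torus.eScalarDissipation (κ j) (θ j) 0 T) atTop (𝓝 0) := by
  have hβpos : 0 < β := by
    have : (0 : ℝ) < β := by linarith [hβ.1]
    exact_mod_cast this
  obtain ⟨C, hC⟩ := DrivasElgindiIyerJeong2022_thm4_l1Velocity d T hT β ⟨hβpos, hβ.2⟩ K M 1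
  have hexp : 0 < 2 * (β : ℝ) - 1 := by linarith [hβ.1]
  have hpow : Tendsto (fun j => κ j ^ (2 * (β : ℝ) - 1)) atTop (𝓝 0) :=
    hκ₀.rpow_const_nhds_zero hexp
  have hup : Tendsto (fun j => ENNReal.ofReal (C * κ j ^ (2 * (β : ℝ) - 1))) atTop (𝓝 0) := by
    have := (hpow.const_mul (C : ℝ))
    simp only [mul_zero] at this
    simpa using ENNReal.tendsto_ofReal this
  -- eventually `κ_j ≤ 1 = κ₀`, where the bound applies
  have hev : ∀ᶠ j in atTop, κ j ≤ 1 :=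
    (hκ₀.eventually (Iic_mem_nhds one_pos)).mono fun j hj => hj
  refine tendsto_of_tendsto_of_tendsto_of_le_of_le' tendsto_const_nhds hup
    (Eventually.of_forall fun _ => bot_le) (hev.mono fun j hj => ?_)
  exact hC (u j) (hub j) (huK j) (θ₀ j) (hθ₀ j) (κ j) (hκ j) (by exact_mod_cast hj) (θ j) (hθ j)
    (henergy j) (hbound j)

end Literature.Barriers.AnomalousDissipation

end
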